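import Summits.ResolutionOfSingularities.ResolutionOfSingularities.Theorems.EquisingularLiftEquisingularLiftNatResidueHypDefsE3
import Summits.ResolutionOfSingularities.ResolutionOfSingularities.Theorems.EquisingularLiftEquisingularLiftNatNoseSectionStepTools
import Summits.ResolutionOfSingularities.ResolutionOfSingularities.Theorems.EquisingularLiftEquisingularLiftNatModelPointStepOfSection
import Summits.ResolutionOfSingularities.ResolutionOfSingularities.Theorems.EquisingularLiftEquisingularLiftNatHostTransportPointStep
import Summits.ResolutionOfSingularities.ResolutionOfSingularities.Theorems.EquisingularLiftEquisingularLiftNatPlaneSideFacts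
import Summits.ResolutionOfSingularities.ResolutionOfSingularities.Theorems.EquisingularLiftEquisingularLiftNatRegularOfSpecialFibre
import Summits.ResolutionOfSingularities.ResolutionOfSingularities.Theorems.EquisingularLiftEquisingularLiftNatStrictTransformVanishingIdeal
import Summits.ResolutionOfSingularities.ResolutionOfSingularities.Theorems.EquisingularLiftEquisingularLiftChainRegular
import Literature.AlgebraicGeometry.Resolution.TransformContainmentOffCentre
import HarnessLib

/-!
# [OURS · L1 W4.5(b) · EL♮(3) · door ν4, D7 brick HNODE] THE NOSE'S SECTION STEP, CONDITIONAL ON ITS TWO LOCAL CORES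
res-L1-w45b-stub-2 g17 (HNODE pen, desk l.84094 / nose-w1 l.84115). `--supports stmt-ResolutionOfSingularities-20148 --as helper`, no claim, counted 0.
OURS; NOT a statement of [Hironaka2017]; AI-written, weaker than expert review. EL♮(3) is NOT proved here; char-p resolution is NOT proved anywhere in this tree.
`hnode_rPlus_of_core` = the HNODE supplier of ✓ `Equinodal.hsube_of_suppliers` (p676659) at `RD := RPlus` (✓ …NatResidueHypDefsE3, p678137) — the
equinodal nose datum through the blow-up of ONE NODE SECTION — ASSEMBLED (K3″ `modelPointStep_of_section`, HT1 `hostClauses_strictTransform_of_nestedSection`,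
tools ✓ p678631, `isIrreducible_closure_preimage_diff_singleton`, `isRegularLocalRing_stalk_of_specializes`, 080E `isBlowup_subscheme_strictTransformIdeal_of_idealSheaf`)
MODULO its two genuinely new local cores, taken as HYPOTHESES with exact signatures: `hTrace` (P6: «the special fibre of the strict transform of the
ORDER-TWO equimultiple nose along the section is the strict transform of the special fibre», `(St_τ 𝓦)·𝒪_{G'} = 𝓘⟨closure υ⁻¹(W ∖ {x})⟩`) and `hNode`
(P5: the reduced downstairs strict transform `W̃'` is regular over `x`). Everything else (new stage, host letter, integrality/flatness of `St 𝓦`, lifted node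
sections and marks, `SplitNodeAt` packages off the centre, regularity of `V(St 𝓦)` off the remaining sections, the node-iff for `W̃'`) is proved here.
-/

set_option linter.dupNamespace false
set_option linter.overlappingInstances false

noncomputable section

open CategoryTheory CategoryTheory.Limits AlgebraicGeometry TopologicalSpace Topology IsLocalRing
open Literature.AlgebraicGeometry.Resolution
open AlgebraicGeometry.Scheme.IdealSheafData
open Summit.ResolutionOfSingularities.ResolutionOfSingularities.Theses.EquisingularLift.Split
open Summit.ResolutionOfSingularities.ResolutionOfSingularities.Cruxes.EquisingularLift.StrataSplit

namespace Summit.ResolutionOfSingularities.ResolutionOfSingularities.Cruxes.EquisingularLiftNat.Sections.Equinodal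

/-- **HNODE at `RD := RPlus`, conditional on the two local cores (P6) `hTrace` and (P5) `hNode`.**  See the module docstring.
[OURS · L1 W4.5b · door ν4 · D7 HNODE assembly, counted 0] -/
theorem hnode_rPlus_of_core (k : Type) [Field k] [IsAlgClosed k]
    (O : Type) [CommRing O] [IsDomain O] [IsDiscreteValuationRing O] [IsAdicComplete (IsLocalRing.maximalIdeal O) O]
    [IsAlgClosed (IsLocalRing.ResidueField O)] (θ : O →+* k) (hθ : Function.Surjective θ)
    (P : Scheme.{0}) (q : P ⟶ Spec (.of O)) (Y : Set P) (Ch : ∀ X' : Scheme.{0}, (X' ⟶ P) → Set X' → Prop)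
    (hChStep : ∀ (X' X'' : Scheme.{0}) (σ' : X' ⟶ P) (S' : Set X') (C : X'.IdealSheafData) (τ : X'' ⟶ X'),
      Ch X' σ' S' → IsBlowup τ C → Scheme.IsRegular C.subscheme → Flat (C.subschemeι ≫ σ' ≫ q) →
      σ' '' (C.support : Set X') ⊆ {y | ¬ IsGenericPoint y Y} → (C.support : Set X') ∩ (σ' ≫ q) ⁻¹' {IsLocalRing.closedPoint O} ⊆ S' →
      Ch X'' (τ ≫ σ') (closure (τ ⁻¹' (S' \ (C.support : Set X')))))
    (hChSplit : ∀ (X' : Scheme.{0}) (σ' : X' ⟶ P) (S' : Set X'), Ch X' σ' S' → Chain P Y X' σ' S')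
    (hYsp : Y ⊆ q ⁻¹' {IsLocalRing.closedPoint O}) (hYirr : IsIrreducible Y) (hYcl : IsClosed Y) (_hPint : IsIntegral P)
    (hPnoeth : IsLocallyNoetherian P) (hPreg : Scheme.IsRegular P) (hqprop : IsProper q) (_hqsm : SmoothOfRelativeDimension 3 q)
    (hTrace : ∀ {X' X'' G G' : Scheme.{0}} (σ' : X' ⟶ P) [IsIntegral X'] [IsLocallyNoetherian X'] [IsLocallyNoetherian X'']
        [IsIntegral G] [IsLocallyNoetherian G] [IsIntegral G'] [IsLocallyNoetherian G'],
        Scheme.IsRegular X' → ∀ (j : G ⟶ X') (t : G ⟶ Spec (.of k)), IsPullback j t (σ' ≫ q) (Spec.map (CommRingCat.ofHom θ)) →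
        ∀ (s : Spec (.of O) ⟶ X'), s ≫ σ' ≫ q = 𝟙 _ → ∀ (τ : X'' ⟶ X'), IsBlowup τ s.ker →
        ∀ (υ : G' ⟶ G) (x : G) (hx : IsClosed ({x} : Set G)), IsBlowup υ (vanishingIdeal ⟨{x}, hx⟩) → s (closedPoint O) = j x →
        ∀ (j₂ : G' ⟶ X'') (t₂ : G' ⟶ Spec (.of k)), IsPullback j₂ t₂ ((τ ≫ σ') ≫ q) (Spec.map (CommRingCat.ofHom θ)) → j₂ ≫ τ = υ ≫ j →
        ∀ (𝓛 𝓦 : X'.IdealSheafData), 𝓛 ≤ 𝓦 → 𝓦 ≤ s.ker → (∀ z : X', (stalkIdeal 𝓛 z).IsPrincipal) → Scheme.IsRegular 𝓛.subscheme →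
        ∀ (E : Set G), 𝓛.comap j = vanishingIdeal (⟨closure E, isClosed_closure⟩ : Closeds G) →
        ∀ (W : Set G) (hW : IsClosed W), 𝓦.comap j = vanishingIdeal (⟨W, hW⟩ : Closeds G) → Flat (𝓦.subschemeι ≫ σ' ≫ q) →
        IsIntegral 𝓦.subscheme → IsIrreducible W → x ∈ W → SplitNodeAt X' 𝓛 𝓦 s.ker (s (closedPoint O)) →
        IsRegularLocalRing (G.presheaf.stalk x) →
        (x ∈ closure E → ∀ e : ↥(redSub G (closure E) isClosed_closure), (redSubι G (closure E) isClosed_closure e : G) = x →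
          IsRegularLocalRing ((redSub G (closure E) isClosed_closure).presheaf.stalk e)) →
        (strictTransformIdeal τ s.ker 𝓦).comap j₂ = vanishingIdeal (⟨closure (υ ⁻¹' (W \ {x})), isClosed_closure⟩ : Closeds G'))
    (hNode : ∀ {X' G G' : Scheme.{0}} (σ' : X' ⟶ P) [IsIntegral X'] [IsLocallyNoetherian X'] [IsIntegral G] [IsLocallyNoetherian G]
        [IsIntegral G'] [IsLocallyNoetherian G'],
        Scheme.IsRegular X' → ∀ (j : G ⟶ X') (t : G ⟶ Spec (.of k)), IsPullback j t (σ' ≫ q) (Spec.map (CommRingCat.ofHom θ)) →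
        ∀ (s : Spec (.of O) ⟶ X'), s ≫ σ' ≫ q = 𝟙 _ →
        ∀ (υ : G' ⟶ G) (x : G) (hx : IsClosed ({x} : Set G)), IsBlowup υ (vanishingIdeal ⟨{x}, hx⟩) → s (closedPoint O) = j x →
        ∀ (𝓛 𝓦 : X'.IdealSheafData), 𝓛 ≤ 𝓦 → 𝓦 ≤ s.ker → (∀ z : X', (stalkIdeal 𝓛 z).IsPrincipal) → Scheme.IsRegular 𝓛.subscheme →
        ∀ (E : Set G), 𝓛.comap j = vanishingIdeal (⟨closure E, isClosed_closure⟩ : Closeds G) →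
        ∀ (W : Set G) (hW : IsClosed W), 𝓦.comap j = vanishingIdeal (⟨W, hW⟩ : Closeds G) → Flat (𝓦.subschemeι ≫ σ' ≫ q) →
        IsIntegral 𝓦.subscheme → IsIrreducible W → x ∈ W → SplitNodeAt X' 𝓛 𝓦 s.ker (s (closedPoint O)) →
        IsRegularLocalRing (G.presheaf.stalk x) →
        (x ∈ closure E → ∀ e : ↥(redSub G (closure E) isClosed_closure), (redSubι G (closure E) isClosed_closure e : G) = x →
          IsRegularLocalRing ((redSub G (closure E) isClosed_closure).presheaf.stalk e)) →
        ∀ z : ↥(redSub G' (closure (υ ⁻¹' (W \ {x}))) isClosed_closure),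
          υ (redSubι G' (closure (υ ⁻¹' (W \ {x}))) isClosed_closure z) = x →
          IsRegularLocalRing ((redSub G' (closure (υ ⁻¹' (W \ {x}))) isClosed_closure).presheaf.stalk z)) :
    ∀ (G G' : Scheme.{0}) (γ : G ⟶ (Literature.AlgebraicGeometry.Motives.projectiveSpace 3 k).left) (T E W : Set G) (hW : IsClosed W)
        (w : ↥(redSub G W hW)) (υ₁ : G' ⟶ G) (hy : IsClosed ({(redSubι G W hW w : G)} : Set G)),
      RPlus k O θ P q Y Ch G γ T E W → W ⊆ T → ¬ IsRegularLocalRing ((redSub G W hW).presheaf.stalk w) →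
      IsRegularLocalRing (G.presheaf.stalk (redSubι G W hW w : G)) →
      ((redSubι G W hW w : G) ∈ closure E → ∀ e : ↥(redSub G (closure E) isClosed_closure),
        (redSubι G (closure E) isClosed_closure e : G) = (redSubι G W hW w : G) →
        IsRegularLocalRing ((redSub G (closure E) isClosed_closure).presheaf.stalk e)) →
      IsBlowup υ₁ (vanishingIdeal (⟨{(redSubι G W hW w : G)}, hy⟩ : Closeds G)) →
      RPlus k O θ P q Y Ch G' (υ₁ ≫ γ) (closure (υ₁ ⁻¹' (T \ {(redSubι G W hW w : G)}))) (closure (υ₁ ⁻¹' (E \ {(redSubι G W hW w : G)})))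
        (closure (υ₁ ⁻¹' (W \ {(redSubι G W hW w : G)}))) := by
  intro G G' γ T E W hW w₀ υ₁ hy hRD hWT hw₀sing hGreg hEreg hυ₁
  classical
  obtain ⟨hTcl, hTirr, hGint, -, hWinf, hWirr, hW', X', σ', S', j, t, hCh, hX'i, hX'n, hX'r, hdom, hsq, hjT, 𝓛, 𝓦, m, 𝔰, w, h𝓛tr, h𝓛pr,
    h𝓛reg, h𝓛off, h𝓛fl, h𝓛𝓦, h𝓦tr, h𝓦fl, h𝓦int, h𝓦reg, h𝔰sec, h𝓦𝔰, hjw, hwinj, hwW, hwcl, hiff, hsplit⟩ := hRD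
  haveI := hPnoeth; haveI := hX'i; haveI := hX'n; haveI := hGint; haveI := hqprop; haveI := h𝓦int
  set x : G := (redSubι G W hW w₀ : G) with hxdef
  haveI : IsClosedImmersion (Spec.map (CommRingCat.ofHom θ)) := IsClosedImmersion.spec_of_surjective _ hθ
  haveI hjci : IsClosedImmersion j := MorphismProperty.IsStableUnderBaseChange.of_isPullback hsq.flip inferInstance
  haveI : IsLocallyNoetherian G := LocallyOfFiniteType.isLocallyNoetherian (f := j)
  have hxW : x ∈ W := by
    have : x ∈ Set.range (redSubι G W hW) := ⟨w₀, rfl⟩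
    rwa [Scheme.IdealSheafData.range_subschemeι, Scheme.IdealSheafData.coe_support_vanishingIdeal] at this
  have hw₀cl : IsClosed ({w₀} : Set ↥(redSub G W hW)) := by
    have : ({w₀} : Set ↥(redSub G W hW)) = (fun z : ↥(redSub G W hW) => (redSubι G W hW z : G)) ⁻¹' {x} := by
      ext z; simp only [Set.mem_singleton_iff, Set.mem_preimage]
      exact ⟨fun h => by rw [h], fun h => (redSubι G W hW).isClosedEmbedding.injective h⟩
    rw [this]; exact hy.preimage (redSubι G W hW).continuous
  obtain ⟨i₀, hi₀⟩ := (hiff w₀ hw₀cl).mp hw₀sing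
  obtain ⟨m', rfl⟩ : ∃ m', m = m' + 1 := ⟨m - 1, by have := i₀.pos; omega⟩
  set s : Spec (.of O) ⟶ X' := 𝔰 i₀ with hsdef
  have hss : s ≫ σ' ≫ q = 𝟙 _ := h𝔰sec i₀
  have hss₀ : s (closedPoint O) = j x := by rw [hxdef, hi₀]; exact (hjw i₀).symm
  have hWx : ¬ W ⊆ {x} := fun h => hWinf ((Set.finite_singleton x).subset h)
  have hTx : ¬ T ⊆ {x} := fun h => hWx (hWT.trans h)
  have hjx𝓦 : j x ∈ (𝓦.support : Set X') := by
    have : x ∈ ((𝓦.comap j).support : Set G) := by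
      rw [h𝓦tr, Scheme.IdealSheafData.coe_support_vanishingIdeal]; exact hxW
    rwa [Scheme.IdealSheafData.support_comap] at this
  have hjx𝓛 : j x ∈ (𝓛.support : Set X') := Scheme.IdealSheafData.support_antitone h𝓛𝓦 hjx𝓦
  have hgen : ¬ IsGenericPoint (σ' (j x)) Y := fun h => h𝓛off ⟨j x, hjx𝓛, rfl⟩ h
  have hch : Chain P Y X' σ' S' := hChSplit _ _ _ hCh
  obtain ⟨-, -, hσ'prop⟩ := chain_isRegular P Y X' σ' S' hch hPnoeth hPreg
  haveI := hσ'prop; haveI : IsProper (σ' ≫ q) := inferInstance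
  obtain ⟨hsci, -, -, hCsupp⟩ := section_isClosedImmersion_and_isRegular_ker O X' (σ' ≫ q) s hss
  haveI := hsci
  have h𝔰ci : ∀ i, IsClosedImmersion (𝔰 i) := fun i => (section_isClosedImmersion_and_isRegular_ker O X' (σ' ≫ q) (𝔰 i) (h𝔰sec i)).1
  have h𝔰supp : ∀ i, ((𝔰 i).ker.support : Set X') = Set.range (𝔰 i) := fun i =>
    (section_isClosedImmersion_and_isRegular_ker O X' (σ' ≫ q) (𝔰 i) (h𝔰sec i)).2.2.2
  have hle : 𝓛 ≤ s.ker := h𝓛𝓦.trans (h𝓦𝔰 i₀)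
  have h𝓛0 : 𝓛 ≠ ⊥ := by
    obtain ⟨ξ, hξ⟩ : ∃ ξ : P, IsGenericPoint ξ Y := QuasiSober.sober hYirr hYcl
    obtain ⟨ξ', hfib', -⟩ := Chain.fibre hch hξ
    intro h0
    have hgen' : ξ' ∈ σ' ⁻¹' {ξ} := by rw [hfib']; exact Set.mem_singleton ξ'
    exact h𝓛off ⟨ξ', by rw [h0, Scheme.IdealSheafData.support_bot]; trivial, rfl⟩ ((show σ' ξ' = ξ from hgen') ▸ hξ)
  obtain ⟨X'', τ, hτ⟩ := exists_isBlowup X' s.ker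
  obtain ⟨hCh'', hX''r, hX''n, hX''i, hdom'', hG'i, hT'irr, hCD, -, -, -, j₂, t₂, hsq₂, hcomm, -, hsets⟩ :=
    modelPointStep_of_section O k θ hθ P q Y hYsp hYirr hYcl Ch hChSplit hChStep X' σ' S' hCh hX'r hdom G j t hsq T hjT x hy (hWT hxW) hTx hgen
      s hss hss₀ X'' τ hτ G' υ₁ hυ₁
  haveI := hX''n; haveI := hX''i; haveI := hG'i; haveI : IsProper τ := hτ.isProper
  haveI hj₂ci : IsClosedImmersion j₂ := MorphismProperty.IsStableUnderBaseChange.of_isPullback hsq₂.flip inferInstance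
  haveI : IsLocallyNoetherian G' := LocallyOfFiniteType.isLocallyNoetherian (f := j₂)
  have hsupp_x : ∀ g : G, j g ∈ (s.ker.support : Set X') → g = x := by
    intro g hg
    have : g ∈ ((s.ker.comap j).support : Set G) := by rw [Scheme.IdealSheafData.support_comap]; exact hg
    rwa [hCD, Scheme.IdealSheafData.coe_support_vanishingIdeal] at this
  obtain ⟨h𝓛₁reg, h𝓛₁pr, h𝓛₁fl, -, h𝓛₁tr⟩ :=
    hostClauses_strictTransform_of_nestedSection O k θ hθ σ' q hX'r j t hsq s hss τ hτ υ₁ j₂ hcomm x hy hυ₁ hCD hss₀ 𝓛 hle h𝓛0 h𝓛reg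
      h𝓛pr h𝓛fl (closure E) isClosed_closure h𝓛tr
  have hclE : closure (υ₁ ⁻¹' (closure E \ {x})) = closure (closure (υ₁ ⁻¹' (E \ {x}))) := by
    rw [closure_closure]
    refine Set.Subset.antisymm (closure_minimal ?_ isClosed_closure) (closure_mono (Set.preimage_mono fun z hz => ⟨subset_closure hz.1, hz.2⟩))
    set U : G.Opens := ⟨(((vanishingIdeal ⟨{x}, hy⟩ : G.IdealSheafData)).support : Set G)ᶜ,
      ((vanishingIdeal ⟨{x}, hy⟩ : G.IdealSheafData)).support.isClosed.isOpen_compl⟩ with hU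
    have hUx : (U : Set G) = {x}ᶜ := by
      rw [hU]; change (((vanishingIdeal ⟨{x}, hy⟩ : G.IdealSheafData)).support : Set G)ᶜ = {x}ᶜ
      rw [Scheme.IdealSheafData.coe_support_vanishingIdeal]; rfl
    haveI : IsIso (υ₁ ∣_ U) := hυ₁.isIso_morphismRestrict (U := U) disjoint_compl_left
    have hoe : IsOpenEmbedding ((υ₁ ⁻¹ᵁ U).ι ≫ υ₁) := by
      rw [← morphismRestrict_ι]; exact ((υ₁ ∣_ U) ≫ U.ι).isOpenEmbedding
    set f := ((υ₁ ⁻¹ᵁ U).ι ≫ υ₁ : _ ⟶ G) with hf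
    have hpre : f ⁻¹' closure E = closure (f ⁻¹' E) := hoe.isOpenMap.preimage_closure_eq_closure_preimage f.continuous E
    intro z hz
    have hzU : z ∈ (υ₁ ⁻¹ᵁ U : Set G') := by
      change υ₁ z ∈ (U : Set G); rw [hUx]; exact hz.2
    obtain ⟨a, rfl⟩ : z ∈ Set.range (υ₁ ⁻¹ᵁ U).ι := by rw [Scheme.Opens.range_ι]; exact hzU
    have ha : a ∈ f ⁻¹' closure E := by show f a ∈ closure E; rw [hf, Scheme.Hom.comp_apply]; exact hz.1
    rw [hpre] at ha
    have himg : (υ₁ ⁻¹ᵁ U).ι '' (f ⁻¹' E) ⊆ υ₁ ⁻¹' (E \ {x}) := by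
      rintro _ ⟨b, hb, rfl⟩
      refine ⟨by have : f b ∈ E := hb; rw [hf, Scheme.Hom.comp_apply] at this; exact this, ?_⟩
      have hbU' : (υ₁ ⁻¹ᵁ U).ι b ∈ (υ₁ ⁻¹ᵁ U : Set G') := by rw [← Scheme.Opens.range_ι]; exact ⟨b, rfl⟩
      have hbU : υ₁ ((υ₁ ⁻¹ᵁ U).ι b) ∈ (U : Set G) := hbU'
      rw [hUx] at hbU; exact hbU
    exact closure_mono himg (map_mem_closure (υ₁ ⁻¹ᵁ U).ι.continuous ha fun b hb => ⟨b, hb, rfl⟩)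
  have h𝓦₁fl : Flat ((strictTransformIdeal τ s.ker 𝓦).subschemeι ≫ (τ ≫ σ') ≫ q) :=
    flat_strictTransform_subschemeι_comp_stage O σ' q τ s.ker hτ 𝓦 h𝓦fl
  have h𝓦supp : ¬ ((𝓦.support : Set X') ⊆ s.ker.support) := by
    intro h
    refine hWx fun g hg => hsupp_x g (h ?_)
    have : g ∈ ((𝓦.comap j).support : Set G) := by rw [h𝓦tr, Scheme.IdealSheafData.coe_support_vanishingIdeal]; exact hg
    rwa [Scheme.IdealSheafData.support_comap] at this
  haveI h𝓦₁int : IsIntegral (strictTransformIdeal τ s.ker 𝓦).subscheme := isIntegral_subscheme_strictTransformIdeal hτ 𝓦 h𝓦supp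
  have hEreg' : x ∈ closure E → ∀ e : ↥(redSub G (closure E) isClosed_closure), (redSubι G (closure E) isClosed_closure e : G) = x →
      IsRegularLocalRing ((redSub G (closure E) isClosed_closure).presheaf.stalk e) := hEreg
  have h𝓦₁tr : (strictTransformIdeal τ s.ker 𝓦).comap j₂ = vanishingIdeal (⟨closure (υ₁ ⁻¹' (W \ {x})), isClosed_closure⟩ : Closeds G') :=
    hTrace σ' hX'r j t hsq s hss τ hτ υ₁ x hy hυ₁ hss₀ j₂ t₂ hsq₂ hcomm 𝓛 𝓦 h𝓛𝓦 (h𝓦𝔰 i₀) h𝓛pr h𝓛reg E h𝓛tr W hW h𝓦tr h𝓦fl h𝓦int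
      hWirr hxW (hsplit i₀) hGreg hEreg'
  have hdisj : ∀ j' : Fin m', Disjoint (Set.range (𝔰 (i₀.succAbove j'))) (s.ker.support : Set X') := by
    intro j'; rw [hCsupp]
    refine disjoint_range_of_sections (σ' ≫ q) (𝔰 (i₀.succAbove j')) s (h𝔰sec _) hss (𝔰 i₀).isClosedEmbedding.isClosed_range ?_
    intro h; rw [← hjw, hsdef, ← hjw] at h
    exact Fin.succAbove_ne i₀ j' (hwinj (hjci.isClosedEmbedding.injective h))
  have hlift : ∀ j' : Fin m', ∃ f₁ : Spec (.of O) ⟶ X'', f₁ ≫ τ = 𝔰 (i₀.succAbove j') ∧ ∀ g : Spec (.of O) ⟶ X'', g ≫ τ = 𝔰 (i₀.succAbove j') → g = f₁ :=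
    fun j' => exists_lift_of_disjoint_support hτ _ (hdisj j')
  choose 𝔰₁ h𝔰₁τ h𝔰₁uniq using hlift
  have h𝔰₁sec : ∀ j', 𝔰₁ j' ≫ (τ ≫ σ') ≫ q = 𝟙 _ := fun j' => by
    have h := h𝔰sec (i₀.succAbove j'); rw [← h𝔰₁τ j'] at h; simpa only [Category.assoc] using h
  have h𝔰₁𝔪 : ∀ j', τ (𝔰₁ j' (closedPoint O)) = 𝔰 (i₀.succAbove j') (closedPoint O) := fun j' => by
    rw [← Scheme.Hom.comp_apply, h𝔰₁τ]
  have h𝔰₁off : ∀ j' a, 𝔰₁ j' a ∉ ((s.ker.comap τ).support : Set X'') := fun j' a =>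
    Set.disjoint_left.mp (range_lift_disjoint_support_comap (hdisj j') (h𝔰₁τ j')) (Set.mem_range_self a)
  have hpts : ∀ j', ∃ w₁ : G', j₂ w₁ = 𝔰₁ j' (closedPoint O) := fun j' =>
    exists_eq_section_closedPoint θ hθ ((τ ≫ σ') ≫ q) j₂ t₂ hsq₂ (𝔰₁ j') (h𝔰₁sec j')
  choose w₁ hw₁ using hpts
  have hυw₁ : ∀ j', υ₁ (w₁ j') = w (i₀.succAbove j') := fun j' =>
    apply_eq_of_section_lift j j₂ hcomm (h𝔰₁τ j') (hjw (i₀.succAbove j')) (hw₁ j')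
  have hw₁ne : ∀ j', υ₁ (w₁ j') ≠ x := fun j' h => by
    rw [hυw₁, hxdef, hi₀] at h; exact Fin.succAbove_ne i₀ j' (hwinj h)
  have hw₁W : ∀ j', w₁ j' ∈ closure (υ₁ ⁻¹' (W \ {x})) := fun j' =>
    subset_closure ⟨show υ₁ (w₁ j') ∈ W by rw [hυw₁]; exact hwW _, hw₁ne j'⟩
  have hw₁inj : Function.Injective w₁ := by
    intro a b h
    have := congrArg υ₁ h; rw [hυw₁, hυw₁] at this; exact Fin.succAbove_right_injective (hwinj this)
  have hxsupp : ((vanishingIdeal ⟨{x}, hy⟩ : G.IdealSheafData).support : Set G) = {x} :=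
    Scheme.IdealSheafData.coe_support_vanishingIdeal _
  have hw₁cl : ∀ j', IsClosed ({w₁ j'} : Set G') := fun j' =>
    isClosed_singleton_of_isBlowup_of_not_mem hυ₁ (by rw [hxsupp]; exact hw₁ne j') (by rw [hυw₁]; exact hwcl _)
  have h𝓦₁𝔰 : ∀ j', strictTransformIdeal τ s.ker 𝓦 ≤ (𝔰₁ j').ker := fun j' =>
    strictTransformIdeal_le_ker_of_le_ker hτ (hdisj j') (h𝔰₁τ j') 𝓦 (h𝓦𝔰 _)
  have hW'T' : closure (υ₁ ⁻¹' (W \ {x})) ⊆ closure (υ₁ ⁻¹' (T \ {x})) :=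
    closure_mono (Set.preimage_mono (Set.sdiff_subset_sdiff_left hWT))
  have hW'irr : IsIrreducible (closure (υ₁ ⁻¹' (W \ {x}))) := isIrreducible_closure_preimage_diff_singleton υ₁ hy hυ₁ hWirr hWx
  have hW'inf : (closure (υ₁ ⁻¹' (W \ {x}))).Infinite := by
    have himg : υ₁ '' (υ₁ ⁻¹' (W \ {x})) = W \ {x} := by
      refine Set.Subset.antisymm (Set.image_preimage_subset _ _) fun g hg => ?_
      obtain ⟨g', hg'⟩ := hυ₁.exists_eq_of_not_mem_support (β := g) (by rw [hxsupp]; exact hg.2)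
      exact ⟨g', by rw [Set.mem_preimage, hg']; exact hg, hg'⟩
    have hinf : (υ₁ ⁻¹' (W \ {x})).Infinite :=
      Set.Infinite.of_image υ₁ (by rw [himg]; exact hWinf.sdiff (Set.finite_singleton x))
    exact hinf.mono subset_closure
  have hNode' : ∀ z : ↥(redSub G' (closure (υ₁ ⁻¹' (W \ {x}))) isClosed_closure),
      υ₁ (redSubι G' (closure (υ₁ ⁻¹' (W \ {x}))) isClosed_closure z) = x →
      IsRegularLocalRing ((redSub G' (closure (υ₁ ⁻¹' (W \ {x}))) isClosed_closure).presheaf.stalk z) :=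
    hNode σ' hX'r j t hsq s hss υ₁ x hy hυ₁ hss₀ 𝓛 𝓦 h𝓛𝓦 (h𝓦𝔰 i₀) h𝓛pr h𝓛reg E h𝓛tr W hW h𝓦tr h𝓦fl h𝓦int hWirr hxW (hsplit i₀)
      hGreg hEreg'
  have hfib : ∀ z : ↥((strictTransformIdeal τ s.ker 𝓦).comap j₂).subscheme,
      υ₁ (((strictTransformIdeal τ s.ker 𝓦).comap j₂).subschemeι z) = x →
      IsRegularLocalRing (((strictTransformIdeal τ s.ker 𝓦).comap j₂).subscheme.presheaf.stalk z) := by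
    rw [h𝓦₁tr]; exact hNode'
  obtain ⟨πW, hπW⟩ := exists_hom_subscheme_strictTransformIdeal_of_idealSheaf τ s.ker 𝓦
  have hblW := isBlowup_subscheme_strictTransformIdeal_of_idealSheaf hτ πW hπW
  have hπWpt : ∀ y, 𝓦.subschemeι (πW y) = τ ((strictTransformIdeal τ s.ker 𝓦).subschemeι y) := fun y => by
    rw [← Scheme.Hom.comp_apply, hπW, Scheme.Hom.comp_apply]
  have hStW : strictTransformIdeal υ₁ (vanishingIdeal ⟨{x}, hy⟩) (vanishingIdeal ⟨W, hW⟩) =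
      vanishingIdeal (⟨closure (υ₁ ⁻¹' (W \ {x})), isClosed_closure⟩ : Closeds G') := by
    rw [strictTransformIdeal_vanishingIdeal_eq υ₁ _ hυ₁ W hW]
    exact congrArg vanishingIdeal (Closeds.ext (by change closure (υ₁ ⁻¹' (W \ _)) = closure (υ₁ ⁻¹' (W \ {x})); rw [hxsupp]))
  have hpack : ∃ πD : redSub G' (closure (υ₁ ⁻¹' (W \ {x}))) isClosed_closure ⟶ redSub G W hW,
      πD ≫ redSubι G W hW = redSubι G' (closure (υ₁ ⁻¹' (W \ {x}))) isClosed_closure ≫ υ₁ ∧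
      IsBlowup πD (((vanishingIdeal ⟨{x}, hy⟩ : G.IdealSheafData)).comap (redSubι G W hW)) := by
    have h0 : ∃ πD : (strictTransformIdeal υ₁ (vanishingIdeal ⟨{x}, hy⟩) (vanishingIdeal ⟨W, hW⟩)).subscheme ⟶ redSub G W hW,
        πD ≫ redSubι G W hW = (strictTransformIdeal υ₁ (vanishingIdeal ⟨{x}, hy⟩) (vanishingIdeal ⟨W, hW⟩)).subschemeι ≫ υ₁ ∧
        IsBlowup πD (((vanishingIdeal ⟨{x}, hy⟩ : G.IdealSheafData)).comap (redSubι G W hW)) := by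
      obtain ⟨πD, hπD⟩ := exists_hom_subscheme_strictTransformIdeal_of_idealSheaf υ₁ (vanishingIdeal ⟨{x}, hy⟩)
        (vanishingIdeal ⟨W, hW⟩)
      exact ⟨πD, hπD, isBlowup_subscheme_strictTransformIdeal_of_idealSheaf hυ₁ πD hπD⟩
    rwa [hStW] at h0
  obtain ⟨πD, hπD, hblD⟩ := hpack
  have hπDpt : ∀ z', (redSubι G W hW (πD z') : G) = υ₁ (redSubι G' (closure (υ₁ ⁻¹' (W \ {x}))) isClosed_closure z') :=
    fun z' => by rw [← Scheme.Hom.comp_apply, hπD, Scheme.Hom.comp_apply]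
  haveI : IsProper υ₁ := hυ₁.isProper
  refine ⟨isClosed_closure, hT'irr, hG'i, hW'T', hW'inf, hW'irr, isClosed_closure, X'', τ ≫ σ', _, j₂, t₂, hCh'', hX''i, hX''n, hX''r,
    hdom'', hsq₂, hsets, strictTransformIdeal τ s.ker 𝓛, strictTransformIdeal τ s.ker 𝓦, m', 𝔰₁, w₁, ?_, h𝓛₁pr, h𝓛₁reg, ?_, h𝓛₁fl,
    strictTransformIdeal_mono τ s.ker h𝓛𝓦, h𝓦₁tr, h𝓦₁fl, h𝓦₁int, ?_, h𝔰₁sec, h𝓦₁𝔰, hw₁, hw₁inj, hw₁W,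
    hw₁cl, ?_, ?_⟩
  · -- host trace
    rw [h𝓛₁tr]; congr 1; exact Closeds.ext hclE
  · -- host off `Y`
    rintro _ ⟨z, hz, rfl⟩
    have hz' : z ∈ ((𝓛.comap τ).support : Set X'') :=
      Scheme.IdealSheafData.support_antitone (comap_le_strictTransformIdeal τ s.ker 𝓛) hz
    rw [Scheme.IdealSheafData.support_comap] at hz'
    exact h𝓛off ⟨τ z, hz', rfl⟩
  · -- `V(St 𝓦)` regular off the remaining sections
    intro x₁ hx₁
    by_cases hc : τ ((strictTransformIdeal τ s.ker 𝓦).subschemeι x₁) ∈ (s.ker.support : Set X')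
    · -- over the blown-up section: specialise inside `V(St 𝓦)` to a point over `𝔪`, where «flat + regular reduced fibre ⇒ regular»
      set ι₁ := (strictTransformIdeal τ s.ker 𝓦).subschemeι with hι₁
      haveI : UniversallyClosed (ι₁ ≫ (τ ≫ σ') ≫ q) := inferInstance
      obtain ⟨x₀, hsp, hx₀⟩ := exists_specializes_over_closedPoint (ι₁ ≫ (τ ≫ σ') ≫ q) x₁
      refine isRegularLocalRing_stalk_of_specializes hsp ?_
      have hc₀ : τ (ι₁ x₀) ∈ (s.ker.support : Set X') := by
        have h1 : τ (ι₁ x₀) ∈ closure {τ (ι₁ x₁)} :=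
          specializes_iff_mem_closure.mp ((hsp.map ι₁.continuous).map τ.continuous)
        exact s.ker.support.isClosed.closure_subset_iff.mpr (Set.singleton_subset_iff.mpr hc) h1
      rw [hCsupp] at hc₀; obtain ⟨a, ha⟩ := hc₀
      have ha𝔪 : a = closedPoint O := by
        have h1 : (σ' ≫ q) (s a) = a := by rw [← Scheme.Hom.comp_apply, hss]; rfl
        have h2 : (ι₁ ≫ (τ ≫ σ') ≫ q) x₀ = closedPoint O := hx₀
        rw [← h1, ha, ← h2]; simp only [Scheme.Hom.comp_apply]
      have hx₀range : ι₁ x₀ ∈ Set.range j₂ := by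
        rw [range_eq_preimage_of_isPullback hsq₂, range_specMap_of_surjective_of_field θ hθ]; exact hx₀
      obtain ⟨g, hg⟩ := hx₀range
      have hgsupp : g ∈ ((((strictTransformIdeal τ s.ker 𝓦).comap j₂)).support : Set G') := by
        rw [Scheme.IdealSheafData.support_comap]
        show j₂ g ∈ ((strictTransformIdeal τ s.ker 𝓦).support : Set X'')
        rw [hg, ← Scheme.IdealSheafData.range_subschemeι]; exact ⟨x₀, rfl⟩
      rw [← Scheme.IdealSheafData.range_subschemeι] at hgsupp; obtain ⟨z, hz⟩ := hgsupp
      have hzx₀ : subschemeMap ((strictTransformIdeal τ s.ker 𝓦).comap j₂) (strictTransformIdeal τ s.ker 𝓦) j₂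
          ((strictTransformIdeal τ s.ker 𝓦).le_map_comap j₂) z = x₀ := by
        apply ι₁.isClosedEmbedding.injective
        rw [hι₁, ← Scheme.Hom.comp_apply, subschemeMap_subschemeι, Scheme.Hom.comp_apply, hz, hg]
      have hυz : υ₁ (((strictTransformIdeal τ s.ker 𝓦).comap j₂).subschemeι z) = x := by
        apply hjci.isClosedEmbedding.injective
        rw [hz, ← Scheme.Hom.comp_apply, ← hcomm, Scheme.Hom.comp_apply, hg, ← ha, ha𝔪, hss₀]
      haveI : Flat ((strictTransformIdeal τ s.ker 𝓦).subschemeι ≫ (τ ≫ σ') ≫ q) := h𝓦₁fl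
      have h := isRegularLocalRing_subscheme_of_model_of_flat O k θ hθ ((τ ≫ σ') ≫ q) j₂ t₂ hsq₂ (strictTransformIdeal τ s.ker 𝓦)
        z (hfib z hυz)
      rwa [hzx₀] at h
    · -- off the centre: `V(St 𝓦) → V(𝓦)` is a local isomorphism, and the image point is off every old section
      have hc' : πW x₁ ∉ (((s.ker).comap 𝓦.subschemeι).support : Set ↥𝓦.subscheme) := by
        rw [Scheme.IdealSheafData.support_comap]
        show 𝓦.subschemeι (πW x₁) ∉ (s.ker.support : Set X')
        rw [hπWpt]; exact hc
      haveI := hblW.isIso_stalkMap_of_not_mem_support hc'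
      have hoffW : ∀ i, 𝓦.subschemeι (πW x₁) ∉ Set.range (𝔰 i) := by
        intro i hi; rw [hπWpt] at hi; by_cases hii : i = i₀
        · subst hii; apply hc; rw [hCsupp]; exact hi
        · obtain ⟨j', rfl⟩ := Fin.exists_succAbove_eq hii
          obtain ⟨a, ha⟩ := hi; refine hx₁ j' ⟨a, ?_⟩
          have h1 : τ (𝔰₁ j' a) = τ ((strictTransformIdeal τ s.ker 𝓦).subschemeι x₁) := by
            rw [← Scheme.Hom.comp_apply, h𝔰₁τ, ha]
          exact eq_of_apply_eq_of_not_mem_of_isBlowup hτ h1 (by rw [h1]; exact hc)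
      haveI := h𝓦reg (πW x₁) hoffW
      exact IsRegularLocalRing.of_ringEquiv (asIso (πW.stalkMap x₁)).commRingCatIsoToRingEquiv
  · -- the node-iff for `W̃'`
    intro z' hz'cl
    have hgcl : IsClosed ({(redSubι G' (closure (υ₁ ⁻¹' (W \ {x}))) isClosed_closure z' : G')} : Set G') := by
      have h := (redSubι G' (closure (υ₁ ⁻¹' (W \ {x}))) isClosed_closure).isClosedEmbedding.isClosedMap _ hz'cl
      rwa [Set.image_singleton] at h
    have hυgcl : IsClosed ({υ₁ (redSubι G' (closure (υ₁ ⁻¹' (W \ {x}))) isClosed_closure z')} : Set G) := by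
      have h := υ₁.isClosedMap _ hgcl; rwa [Set.image_singleton] at h
    have hπDcl : IsClosed ({πD z'} : Set ↥(redSub G W hW)) := by
      have : ({πD z'} : Set ↥(redSub G W hW)) =
          (fun y : ↥(redSub G W hW) => (redSubι G W hW y : G)) ⁻¹' {υ₁ (redSubι G' (closure (υ₁ ⁻¹' (W \ {x}))) isClosed_closure z')} := by
        ext y; simp only [Set.mem_singleton_iff, Set.mem_preimage]
        exact ⟨fun h => by rw [h]; exact hπDpt z', fun h => (redSubι G W hW).isClosedEmbedding.injective (h.trans (hπDpt z').symm)⟩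
      rw [this]; exact hυgcl.preimage (redSubι G W hW).continuous
    by_cases hzx : υ₁ (redSubι G' (closure (υ₁ ⁻¹' (W \ {x}))) isClosed_closure z') = x
    · -- over `x`: regular by (P5), and no mark lies over `x`
      exact ⟨fun h => absurd (hNode' z' hzx) h, fun ⟨j', hj'⟩ => absurd (hj' ▸ hzx) (hw₁ne j')⟩
    · -- off `x`: the stalks of `W̃'` and `W̃` agree along `πD`
      have hoffD : πD z' ∉ ((((vanishingIdeal ⟨{x}, hy⟩ : G.IdealSheafData)).comap (redSubι G W hW)).support : Set ↥(redSub G W hW)) := by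
        rw [Scheme.IdealSheafData.support_comap]
        show (redSubι G W hW (πD z') : G) ∉ (((vanishingIdeal ⟨{x}, hy⟩ : G.IdealSheafData)).support : Set G)
        rw [hxsupp, hπDpt]; exact hzx
      haveI := hblD.isIso_stalkMap_of_not_mem_support hoffD
      have hiffD : IsRegularLocalRing ((redSub G W hW).presheaf.stalk (πD z')) ↔
          IsRegularLocalRing ((redSub G' (closure (υ₁ ⁻¹' (W \ {x}))) isClosed_closure).presheaf.stalk z') :=
        ⟨fun h => IsRegularLocalRing.of_ringEquiv (asIso (πD.stalkMap z')).commRingCatIsoToRingEquiv,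
          fun h => IsRegularLocalRing.of_ringEquiv (asIso (πD.stalkMap z')).commRingCatIsoToRingEquiv.symm⟩
      constructor
      · intro hnreg
        obtain ⟨i, hi⟩ := (hiff (πD z') hπDcl).mp (fun h => hnreg (hiffD.mp h))
        have hii : i ≠ i₀ := fun h => hzx (by rw [← hπDpt, hi, h, ← hi₀])
        obtain ⟨j', rfl⟩ := Fin.exists_succAbove_eq hii
        refine ⟨j', ?_⟩
        have h1 : υ₁ (redSubι G' (closure (υ₁ ⁻¹' (W \ {x}))) isClosed_closure z') = υ₁ (w₁ j') := by
          rw [← hπDpt, hi, hυw₁]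
        exact eq_of_apply_eq_of_not_mem_of_isBlowup hυ₁ h1 (by rw [hxsupp]; exact hzx)
      · rintro ⟨j', hj'⟩ h
        refine (hiff (πD z') hπDcl).mpr ⟨i₀.succAbove j', ?_⟩ (hiffD.mpr h)
        rw [hπDpt, hj', hυw₁]
  · -- the split-node packages of the remaining sections transport along `τ`'s stalk isomorphisms
    intro j'
    have hp₁ : 𝔰₁ j' (closedPoint O) ∉ ((s.ker.comap τ).support : Set X'') := h𝔰₁off j' _
    haveI := hτ.isIso_stalkMap_of_not_mem_exceptional hp₁
    have hL := stalkIdeal_strictTransformIdeal_eq_map_ringEquiv hτ 𝓛 hp₁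
    have hWs := stalkIdeal_strictTransformIdeal_eq_map_ringEquiv hτ 𝓦 hp₁
    haveI := h𝔰ci (i₀.succAbove j')
    haveI : IsClosedImmersion (𝔰₁ j') :=
      (section_isClosedImmersion_and_isRegular_ker O X'' ((τ ≫ σ') ≫ q) (𝔰₁ j') (h𝔰₁sec j')).1
    have hS := stalkIdeal_ker_eq_map_of_comp hτ (𝔰₁ j') (𝔰 (i₀.succAbove j')) (h𝔰₁τ j') (closedPoint O) hp₁
    have hsp : SplitNodeAt X' 𝓛 𝓦 (𝔰 (i₀.succAbove j')).ker (τ (𝔰₁ j' (closedPoint O))) := by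
      rw [h𝔰₁𝔪]; exact hsplit _
    unfold SplitNodeAt at hsp ⊢
    obtain ⟨u, v, g, a, b, c, h, h1, h2, h3, h4, h5⟩ :=
      exists_splitNode_map_of_ringEquiv (asIso (τ.stalkMap (𝔰₁ j' (closedPoint O)))).commRingCatIsoToRingEquiv _ _ _ hsp
    refine ⟨u, v, g, a, b, c, h, ?_, ?_, h3, ?_, h5⟩
    · rw [hS, hL]; exact h1
    · rw [hWs, hL]; exact h2
    · rw [hL]; exact h4

end Summit.ResolutionOfSingularities.ResolutionOfSingularities.Cruxes.EquisingularLiftNat.Sections.Equinodal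

end
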